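import Literature.MathematicalPhysics.QuantumLattice.HubbardSpinChargeCertificate
import Literature.MathematicalPhysics.QuantumLattice.HubbardHalfFilledSectorOrdering
import Literature.MathematicalPhysics.QuantumLattice.HubbardSpinReflectionSignRule
import Literature.MathematicalPhysics.QuantumLattice.HubbardSectorCorrelatorCertificate
import Literature.MathematicalPhysics.QuantumLattice.HubbardHalfFilledPseudospinSinglet
import HarnessLib

/-!
# Sector-mode bootstrap certificates with highest-weight (`S⁺`) and singlet (`S^±`) rows

Family `hubbard` (topic `MathematicalPhysics/QuantumLattice`); companion of
`HubbardSpinChargeCertificate` (`groundEnergyAt_ge_of_certificate_charged`: commutator, number-ideal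
and charged-word null terms) and `HubbardHalfFilledSectorOrdering` (Lieb–Mattis ordering at half
filling), written for the certified-numerics cell `pub-mbboot` and the engines' "singlet rows"
(certsdp `ideal_ops` `Σ S⁺`, `Σ S⁻` under the licence "Lieb 1989 Thm 2": Hubbard, `U > 0`,
`t ≠ 0`, connected bipartite graph with `|A| = |B|`, `N = |Λ|`, `S^z = 0`).

**Soundness of such rows, and of their one-sided extension to the sectors `S^z = M ≥ S₀`.**
Under Lieb's hypotheses (connected bipartite `G` with colour class `A`, `t ≠ 0`, `U > 0`) the
ground state `ψ` of `H = hamiltonian G t U` in the coordinate sector `(N↑, N↓) = (p, q)`,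
`p + q = |Λ|`, is unique, and for `q ≤ |A|`, `q ≤ |Aᶜ|` (`M = (p - q)/2 ≥ S₀`) it satisfies
`S⁺ ψ = 0` (`hubbard_halfFilled_upDownSector_groundState_spin`; Tasaki 1998 §5 / Lieb 1989).
Consequently, in a certificate identity evaluated in the vector state of `ψ`, besides the null
terms of `groundEnergyAt_ge_of_certificate_charged` (commutators `H X − X H`, number-ideal terms
`Y (N̂ − N) + (N̂ − N) Y'`, words of non-zero particle or spin charge) one may use

* **highest-weight rows** `Σᵢ (Vᵢ S⁺ + S⁻ V'ᵢ)` — `⟨ψ, Vᵢ S⁺ ψ⟩ = 0` and `⟨ψ, S⁻ V'ᵢ ψ⟩ =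
  ⟨S⁺ψ, V'ᵢ ψ⟩ = 0` — in EVERY sector with `q ≤ |A|, |Aᶜ|`
  (`hubbard_halfFilled_minEnergyOn_szSector_ge_of_certificate_hw`: the identity proves
  `c − Σₖ ‖aₖ‖ ≤ E(p, q) = H.minEnergyOn (szSector (p+q) ((p-q)/2))`);
* **singlet rows** `Σᵢ (Vᵢ S⁺ + S⁻ V'ᵢ) + Σᵢ (Wᵢ S⁻ + S⁺ W'ᵢ)` in the central sector `p = q`
  (`S² ψ = 0`, hence `S^± ψ = 0`), where `E(n, n) = E₀(2n)` is the half-filled ground-state energy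
  (`hubbard_halfFilled_groundEnergyAt_ge_of_certificate_singlet`);
* the even square torus forms `hubbardTorus_…` (`fermionTorusGraph 2 L`, `L` even, any `q ≤ p`,
  `p + q = L²`);
* the same rows in ENERGY-CONSTRAINED CORRELATOR certificates (Wang et al. 2024 §3, tree
  `re_dotProduct_ge_of_sector_certificate_ineq`): `re_dotProduct_ge_of_sector_certificate_singlet`
  (identity level, for a unit ground vector with `S⁺ψ = S⁻ψ = 0`) and
  `hubbardTorus_groundState_re_dotProduct_ge_of_sector_certificate_singlet` (every unit
  `L²`-particle ground vector of the even torus, `t ≠ 0`, `U > 0`) — by folding the singlet rows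
  into the objective, whose expectation they do not change;
* the GENERAL ANNIHILATOR FORM `Σᵢ (Rᵢ Gᵢ + Gᵢᴴ R'ᵢ)` with `Gᵢ ψ = 0`
  (`re_dotProduct_ge_of_sector_certificate_annihilators`, identity level), and its half-filled
  even-torus instance where each `Gᵢ` is one of `S⁺, S⁻, η_ε, η†_ε` (`ε` = Yang's staggering
  `torusStagger`; the ground state is a spin singlet AND a pseudospin singlet, tree
  `hubbardTorus_eta_mulVec_eq_zero`): `hubbardTorus_groundState_re_dotProduct_ge_of_sector_certificate_annihilators`
  (correlator windows) and `hubbardTorus_groundEnergyAt_ge_of_certificate_annihilators` (energy).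

These are the Lean soundness edges for certsdp sector-mode certificates carrying `S^±` ideal rows
(engines REQUESTS `eng-sdp-1-g2-singlet-rows-predicate-staged`, `mbboot-lit-g17-highest-weight-rows`).
Everything is PROVED; no definition, no named fact.

## References
* X. Han, *Quantum many-body bootstrap*, arXiv:2006.06002 (2020), §2 (null constraints from
  symmetries and conserved charges). [cite: Han2020Bootstrap, §2]
* H. Tasaki, J. Phys.: Condens. Matter 10 (1998) 4353, §5 (Lieb's theorem and the Lieb–Mattis
  ordering at half filling). [cite: Tasaki1998, §5]
* E. H. Lieb, PRL 62 (1989) 1201, Theorems 1–2. [cite: LiebPRL1989]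
-/

noncomputable section

open Matrix Finset
open scoped ComplexOrder BigOperators
open Literature.MathematicalPhysics.QuantumManyBody.StateRelaxation

namespace Literature.MathematicalPhysics.QuantumLattice

variable {Λ : Type*} [LinearOrder Λ] [Fintype Λ] (G : SimpleGraph Λ) [DecidableRel G.Adj]

/-! ### The highest-weight sector ground state -/

/-- **A unit highest-weight ground state of the sector `(p, q)` at half filling.** Under Lieb's
hypotheses, for `p + q = |Λ|`, `q ≤ |A|`, `q ≤ |Aᶜ|` there is a unit vector `ψ` of the coordinate
sector `(N↑, N↓) = (p, q)` with `H ψ = E(p, q) ψ` and `S⁺ ψ = 0`.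
Tasaki (1998) §5; Lieb, PRL 62 (1989) 1201. [cite: Tasaki1998, §5] -/
theorem hubbard_halfFilled_exists_unit_sector_groundState_hw (hG : G.Connected) (A : Finset Λ)
    (hA : ∀ x y : Λ, G.Adj x y → (x ∈ A ↔ y ∉ A)) {t U : ℝ} (ht : t ≠ 0) (hU : 0 < U)
    {p q : ℕ} (hpq : p + q = Fintype.card Λ) (hqA : q ≤ A.card) (hqB : q ≤ Aᶜ.card) :
    ∃ ψ : Fock (Orb Λ), IsInSector p q ψ ∧ star ψ ⬝ᵥ ψ = 1 ∧
      hamiltonian G t U *ᵥ ψ =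
        (((hamiltonian G t U).minEnergyOn (szSector (p + q) (((p : ℝ) - q) / 2)) : ℝ) : ℂ) • ψ ∧
      spinPlus *ᵥ ψ = 0 := by
  obtain ⟨ψ₀, hψ₀, hψ₀0, hHψ₀, -⟩ :=
    hubbard_halfFilled_upDownSector_groundState_unique G hG A hA ht hU hpq
  obtain ⟨c, -, hc1⟩ := Literature.MathematicalPhysics.QuantumLattice.exists_smul_unit hψ₀0
  have hsec : IsInSector p q (c • ψ₀) := hψ₀.smul c
  have hH : hamiltonian G t U *ᵥ (c • ψ₀) =
      (((hamiltonian G t U).minEnergyOn (szSector (p + q) (((p : ℝ) - q) / 2)) : ℝ) : ℂ) • (c • ψ₀) := by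
    rw [mulVec_smul, hHψ₀, smul_comm]
  exact ⟨c • ψ₀, hsec, hc1, hH,
    (hubbard_halfFilled_upDownSector_groundState_spin G hG A hA ht hU hpq hqA hqB hsec hH).1⟩

/-- **A unit singlet ground state of the central sector `(n, n)` at half filling** (`|Λ| = 2n`,
`n ≤ |A|, |Aᶜ|`, i.e. `|A| = |Aᶜ| = n`): `H ψ = E(n, n) ψ`, `S⁺ ψ = 0`, `S⁻ ψ = 0`.
Lieb, PRL 62 (1989) 1201, Theorem 2 (`S = 0`). [cite: LiebPRL1989, Theorem 2] -/
theorem hubbard_halfFilled_exists_unit_sector_groundState_singlet (hG : G.Connected) (A : Finset Λ)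
    (hA : ∀ x y : Λ, G.Adj x y → (x ∈ A ↔ y ∉ A)) {t U : ℝ} (ht : t ≠ 0) (hU : 0 < U)
    {n : ℕ} (hn : n + n = Fintype.card Λ) (hnA : n ≤ A.card) (hnB : n ≤ Aᶜ.card) :
    ∃ ψ : Fock (Orb Λ), IsInSector n n ψ ∧ star ψ ⬝ᵥ ψ = 1 ∧
      hamiltonian G t U *ᵥ ψ =
        (((hamiltonian G t U).minEnergyOn (szSector (n + n) (((n : ℝ) - n) / 2)) : ℝ) : ℂ) • ψ ∧
      spinPlus *ᵥ ψ = 0 ∧ Literature.MathematicalPhysics.QuantumLattice.spinMinus *ᵥ ψ = 0 := by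
  obtain ⟨ψ, hψ, hψ1, hHψ, hP⟩ :=
    hubbard_halfFilled_exists_unit_sector_groundState_hw G hG A hA ht hU hn hnA hnB
  obtain ⟨-, hS2⟩ := hubbard_halfFilled_upDownSector_groundState_spin G hG A hA ht hU hn hnA hnB hψ hHψ
  have hS0 : spinSq *ᵥ ψ = 0 := by
    rw [hS2, sub_self, zero_div, zero_mul, Complex.ofReal_zero, zero_smul]
  obtain ⟨-, hM, -⟩ := spin_mulVec_eq_zero_of_spinSq_mulVec_eq_zero hS0
  exact ⟨ψ, hψ, hψ1, hHψ, hP, hM⟩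

/-! ### Certificates with highest-weight rows -/

/-- **Sector-mode bootstrap certificate with highest-weight rows ⇒ sector energy lower bound.**
Under Lieb's hypotheses (connected bipartite `G`, colour class `A`, `t ≠ 0`, `U > 0`), for the
sector `(N↑, N↓) = (p, q)` of the half-filled model, `p + q = |Λ|`, `q ≤ |A|`, `q ≤ |Aᶜ|`: an identity
`H − c·1 = Σᵢⱼ Λᵢⱼ Oᵢᴴ Oⱼ + (((Σₖ (H Xₖ − Xₖ H) + Σₗ (Yₗ (N̂ − N) + (N̂ − N) Y'ₗ)) + Σⱼ bⱼ wⱼ)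
  + Σᵢ (Vᵢ S⁺ + S⁻ V'ᵢ)) + Σₖ aₖ vₖ`
with `Λ ⪰ 0`, `N = p + q`, CHARGED ladder words `wⱼ` (`ladderCharge wⱼ ≠ 0 ∨ ladderSpinCharge wⱼ ≠ 0`),
arbitrary matrices `Vᵢ, V'ᵢ` and residual ladder words `vₖ` proves
`c − Σₖ ‖aₖ‖ ≤ E(p, q) = H.minEnergyOn (szSector (p + q) ((p - q)/2))`: evaluate in the vector state
of the unit highest-weight sector ground state (`S⁺ψ = 0`, so `⟨ψ, V S⁺ ψ⟩ = 0 = ⟨ψ, S⁻ V' ψ⟩`).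
Han 2020 §2 (symmetry null constraints); Tasaki 1998 §5. [cite: Han2020Bootstrap, §2] -/
theorem hubbard_halfFilled_minEnergyOn_szSector_ge_of_certificate_hw (hG : G.Connected) (A : Finset Λ)
    (hA : ∀ x y : Λ, G.Adj x y → (x ∈ A ↔ y ∉ A)) {t U : ℝ} (ht : t ≠ 0) (hU : 0 < U)
    {p q : ℕ} (hpq : p + q = Fintype.card Λ) (hqA : q ≤ A.card) (hqB : q ≤ Aᶜ.card)
    {m : Type*} [Fintype m] [DecidableEq m] {Λm : Matrix m m ℂ} (hΛ : Λm.PosSemidef)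
    (O : m → Matrix (Finset (Orb Λ)) (Finset (Orb Λ)) ℂ)
    {κ : Type*} (s : Finset κ) (X : κ → Matrix (Finset (Orb Λ)) (Finset (Orb Λ)) ℂ)
    {κ' : Type*} (s' : Finset κ') (Y Y' : κ' → Matrix (Finset (Orb Λ)) (Finset (Orb Λ)) ℂ)
    {ρ : Type*} (u : Finset ρ) (b : ρ → ℂ) (cw : ρ → List (Orb Λ × Bool))
    (hcw : ∀ j ∈ u, ladderCharge (cw j) ≠ 0 ∨ ladderSpinCharge (cw j) ≠ 0)
    {ν : Type*} (sv : Finset ν) (V V' : ν → Matrix (Finset (Orb Λ)) (Finset (Orb Λ)) ℂ)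
    {κ'' : Type*} (w : Finset κ'') (a : κ'' → ℂ) (word : κ'' → List (Orb Λ × Bool)) {c : ℝ}
    (hcert : hamiltonian G t U - (c : ℂ) • (1 : Matrix (Finset (Orb Λ)) (Finset (Orb Λ)) ℂ) =
      gramForm Λm O +
        (((∑ k ∈ s, (hamiltonian G t U * X k - X k * hamiltonian G t U) +
          ∑ l ∈ s', (Y l * (totalNumberOp - ((p + q : ℕ) : ℂ) • 1) +
            (totalNumberOp - ((p + q : ℕ) : ℂ) • 1) * Y' l)) +
          ∑ j ∈ u, b j • ladderWord (cw j)) +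
          ∑ i ∈ sv, (V i * spinPlus + Literature.MathematicalPhysics.QuantumLattice.spinMinus * V' i)) +
        ∑ k ∈ w, a k • ladderWord (word k)) :
    c - ∑ k ∈ w, ‖a k‖ ≤ (hamiltonian G t U).minEnergyOn (szSector (p + q) (((p : ℝ) - q) / 2)) := by
  obtain ⟨ψ, hψ, hψ1, hHψ, hP⟩ :=
    hubbard_halfFilled_exists_unit_sector_groundState_hw G hG A hA ht hU hpq hqA hqB
  set N := p + q with hN
  have hψN : IsNParticle N ψ := hψ.isNParticle
  have hSψ : HubbardWave0.spinZ *ᵥ ψ = (((((p : ℝ) - q) / 2 : ℝ)) : ℂ) • ψ := by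
    rw [LiebThm1.spinZ_mulVec_of_isInSector hψ]; congr 1; push_cast; ring
  set ω := vectorState ψ with hω
  have hpos : ∀ x : Matrix (Finset (Orb Λ)) (Finset (Orb Λ)) ℂ, 0 ≤ ω (star x * x) :=
    fun x => vectorState_nonneg ψ x
  have hone : ω 1 = 1 := by rw [hω, vectorState_apply, one_mulVec, hψ1]
  have hHh := LiebThm1.hamiltonian_isHermitian G t U
  have hnull : ω (((∑ k ∈ s, (hamiltonian G t U * X k - X k * hamiltonian G t U) +
      ∑ l ∈ s', (Y l * (totalNumberOp - (N : ℂ) • 1) + (totalNumberOp - (N : ℂ) • 1) * Y' l)) +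
      ∑ j ∈ u, b j • ladderWord (cw j)) +
      ∑ i ∈ sv, (V i * spinPlus + Literature.MathematicalPhysics.QuantumLattice.spinMinus * V' i)) = 0 := by
    rw [map_add, map_add, map_add, map_sum, map_sum, map_sum, map_sum]
    have h1 : ∀ k ∈ s, ω (hamiltonian G t U * X k - X k * hamiltonian G t U) = 0 :=
      fun k _ => vectorState_commutator hHh hHψ _
    have h2 : ∀ l ∈ s',
        ω (Y l * (totalNumberOp - (N : ℂ) • 1) + (totalNumberOp - (N : ℂ) • 1) * Y' l) = 0 :=
      fun l _ => by
        have hZ : (totalNumberOp - (N : ℂ) • (1 : Matrix (Finset (Orb Λ)) (Finset (Orb Λ)) ℂ)) *ᵥ ψ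
            = 0 := totalNumberOp_sub_mulVec_of_isNParticle N hψN
        have hZ' : (totalNumberOp - (N : ℂ) • (1 : Matrix (Finset (Orb Λ)) (Finset (Orb Λ)) ℂ))ᴴ *ᵥ ψ
            = 0 := by rw [conjTranspose_totalNumberOp_sub]; exact hZ
        have e1 : vectorState ψ (Y l * (totalNumberOp - (N : ℂ) •
            (1 : Matrix (Finset (Orb Λ)) (Finset (Orb Λ)) ℂ))) = 0 :=
          vectorState_mul_of_mulVec_eq_zero ψ (Y l) hZ
        have e2 : vectorState ψ ((totalNumberOp - (N : ℂ) •
            (1 : Matrix (Finset (Orb Λ)) (Finset (Orb Λ)) ℂ)) * Y' l) = 0 :=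
          vectorState_mul_of_conjTranspose_mulVec_eq_zero ψ (Y' l) hZ'
        rw [map_add, hω, e1, e2, add_zero]
    have h3 : ∀ j ∈ u, ω (b j • ladderWord (cw j)) = 0 := fun j hj => by
      rw [map_smul, hω, vectorState_apply, smul_eq_mul]
      rcases hcw j hj with hq | hq
      · rw [star_dotProduct_ladderWord_mulVec_eq_zero hψN (cw j) hq, mul_zero]
      · rw [star_dotProduct_ladderWord_mulVec_eq_zero_of_spinCharge hSψ (cw j) hq, mul_zero]
    have h4 : ∀ i ∈ sv,
        ω (V i * spinPlus + Literature.MathematicalPhysics.QuantumLattice.spinMinus * V' i) = 0 :=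
      fun i _ => by
        have hP' : (Literature.MathematicalPhysics.QuantumLattice.spinMinus :
            Matrix (Finset (Orb Λ)) (Finset (Orb Λ)) ℂ)ᴴ *ᵥ ψ = 0 := by
          rw [Literature.MathematicalPhysics.QuantumLattice.spinMinus, conjTranspose_conjTranspose]
          exact hP
        have e1 : vectorState ψ (V i * spinPlus) = 0 := vectorState_mul_of_mulVec_eq_zero ψ (V i) hP
        have e2 : vectorState ψ (Literature.MathematicalPhysics.QuantumLattice.spinMinus * V' i) = 0 :=
          vectorState_mul_of_conjTranspose_mulVec_eq_zero ψ (V' i) hP'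
        rw [map_add, hω, e1, e2, add_zero]
    rw [Finset.sum_eq_zero h1, Finset.sum_eq_zero h2, Finset.sum_eq_zero h3, Finset.sum_eq_zero h4,
      add_zero, add_zero, add_zero]
  have hr : -(∑ k ∈ w, ‖a k‖) ≤ (ω (∑ k ∈ w, a k • ladderWord (word k))).re :=
    neg_sum_norm_le_re_map_sum w ω a (fun k => ladderWord (word k)) fun k _ => by
      have h := (isContraction_prod_ladder (word k)).neg_norm_mul_le (a k) ψ
      rw [hψ1, Complex.one_re, mul_one] at h
      rw [hω, vectorState_apply, ladderWord_eq_prod]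
      exact h
  have h := le_re_map_of_certificate_residual ω hpos hone hΛ O hnull hr hcert
  rwa [hω, vectorState_apply, hHψ, dotProduct_smul, hψ1, smul_eq_mul, mul_one,
    Complex.ofReal_re] at h

/-- **Central sector: bootstrap certificate with singlet rows ⇒ half-filled ground-energy lower
bound.** Under Lieb's hypotheses with `|Λ| = 2n`, `n ≤ |A|`, `n ≤ |Aᶜ|` (so `|A| = |Aᶜ| = n`): an
identity as in `hubbard_halfFilled_minEnergyOn_szSector_ge_of_certificate_hw` for the sector
`(n, n)` with, in addition, the rows `Σᵢ (Wᵢ S⁻ + S⁺ W'ᵢ)`, proves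
`c − Σₖ ‖aₖ‖ ≤ groundEnergyAt G t U (2n)` (the half-filled ground state is the unique singlet of the
central sector: `S⁺ψ = S⁻ψ = 0`; `E₀(2n) = E(n, n)`). Han 2020 §2; Lieb 1989 Theorem 2.
[cite: Han2020Bootstrap, §2] -/
theorem hubbard_halfFilled_groundEnergyAt_ge_of_certificate_singlet (hG : G.Connected) (A : Finset Λ)
    (hA : ∀ x y : Λ, G.Adj x y → (x ∈ A ↔ y ∉ A)) {t U : ℝ} (ht : t ≠ 0) (hU : 0 < U)
    {n : ℕ} (hn : n + n = Fintype.card Λ) (hnA : n ≤ A.card) (hnB : n ≤ Aᶜ.card)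
    {m : Type*} [Fintype m] [DecidableEq m] {Λm : Matrix m m ℂ} (hΛ : Λm.PosSemidef)
    (O : m → Matrix (Finset (Orb Λ)) (Finset (Orb Λ)) ℂ)
    {κ : Type*} (s : Finset κ) (X : κ → Matrix (Finset (Orb Λ)) (Finset (Orb Λ)) ℂ)
    {κ' : Type*} (s' : Finset κ') (Y Y' : κ' → Matrix (Finset (Orb Λ)) (Finset (Orb Λ)) ℂ)
    {ρ : Type*} (u : Finset ρ) (b : ρ → ℂ) (cw : ρ → List (Orb Λ × Bool))
    (hcw : ∀ j ∈ u, ladderCharge (cw j) ≠ 0 ∨ ladderSpinCharge (cw j) ≠ 0)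
    {ν : Type*} (sv : Finset ν) (V V' : ν → Matrix (Finset (Orb Λ)) (Finset (Orb Λ)) ℂ)
    {ν' : Type*} (sw : Finset ν') (W W' : ν' → Matrix (Finset (Orb Λ)) (Finset (Orb Λ)) ℂ)
    {κ'' : Type*} (w : Finset κ'') (a : κ'' → ℂ) (word : κ'' → List (Orb Λ × Bool)) {c : ℝ}
    (hcert : hamiltonian G t U - (c : ℂ) • (1 : Matrix (Finset (Orb Λ)) (Finset (Orb Λ)) ℂ) =
      gramForm Λm O +
        (((∑ k ∈ s, (hamiltonian G t U * X k - X k * hamiltonian G t U) +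
          ∑ l ∈ s', (Y l * (totalNumberOp - ((n + n : ℕ) : ℂ) • 1) +
            (totalNumberOp - ((n + n : ℕ) : ℂ) • 1) * Y' l)) +
          ∑ j ∈ u, b j • ladderWord (cw j)) +
          (∑ i ∈ sv, (V i * spinPlus + Literature.MathematicalPhysics.QuantumLattice.spinMinus * V' i) +
           ∑ i ∈ sw, (W i * Literature.MathematicalPhysics.QuantumLattice.spinMinus + spinPlus * W' i))) +
        ∑ k ∈ w, a k • ladderWord (word k)) :
    c - ∑ k ∈ w, ‖a k‖ ≤ groundEnergyAt G t U (2 * n) := by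
  obtain ⟨ψ, hψ, hψ1, hHψ, hP, hM⟩ :=
    hubbard_halfFilled_exists_unit_sector_groundState_singlet G hG A hA ht hU hn hnA hnB
  set N := n + n with hN
  have hψN : IsNParticle N ψ := hψ.isNParticle
  have hSψ : HubbardWave0.spinZ *ᵥ ψ = (((((n : ℝ) - n) / 2 : ℝ)) : ℂ) • ψ := by
    rw [LiebThm1.spinZ_mulVec_of_isInSector hψ]; congr 1; push_cast; ring
  set ω := vectorState ψ with hω
  have hpos : ∀ x : Matrix (Finset (Orb Λ)) (Finset (Orb Λ)) ℂ, 0 ≤ ω (star x * x) :=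
    fun x => vectorState_nonneg ψ x
  have hone : ω 1 = 1 := by rw [hω, vectorState_apply, one_mulVec, hψ1]
  have hHh := LiebThm1.hamiltonian_isHermitian G t U
  have hP' : (Literature.MathematicalPhysics.QuantumLattice.spinMinus :
      Matrix (Finset (Orb Λ)) (Finset (Orb Λ)) ℂ)ᴴ *ᵥ ψ = 0 := by
    rw [Literature.MathematicalPhysics.QuantumLattice.spinMinus, conjTranspose_conjTranspose]
    exact hP
  have hM' : (spinPlus : Matrix (Finset (Orb Λ)) (Finset (Orb Λ)) ℂ)ᴴ *ᵥ ψ = 0 := hM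
  have hnull : ω (((∑ k ∈ s, (hamiltonian G t U * X k - X k * hamiltonian G t U) +
      ∑ l ∈ s', (Y l * (totalNumberOp - (N : ℂ) • 1) + (totalNumberOp - (N : ℂ) • 1) * Y' l)) +
      ∑ j ∈ u, b j • ladderWord (cw j)) +
      (∑ i ∈ sv, (V i * spinPlus + Literature.MathematicalPhysics.QuantumLattice.spinMinus * V' i) +
       ∑ i ∈ sw, (W i * Literature.MathematicalPhysics.QuantumLattice.spinMinus + spinPlus * W' i))) = 0 := by
    rw [map_add, map_add, map_add, map_add, map_sum, map_sum, map_sum, map_sum, map_sum]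
    have h1 : ∀ k ∈ s, ω (hamiltonian G t U * X k - X k * hamiltonian G t U) = 0 :=
      fun k _ => vectorState_commutator hHh hHψ _
    have h2 : ∀ l ∈ s',
        ω (Y l * (totalNumberOp - (N : ℂ) • 1) + (totalNumberOp - (N : ℂ) • 1) * Y' l) = 0 :=
      fun l _ => by
        have hZ : (totalNumberOp - (N : ℂ) • (1 : Matrix (Finset (Orb Λ)) (Finset (Orb Λ)) ℂ)) *ᵥ ψ
            = 0 := totalNumberOp_sub_mulVec_of_isNParticle N hψN
        have hZ' : (totalNumberOp - (N : ℂ) • (1 : Matrix (Finset (Orb Λ)) (Finset (Orb Λ)) ℂ))ᴴ *ᵥ ψ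
            = 0 := by rw [conjTranspose_totalNumberOp_sub]; exact hZ
        have e1 : vectorState ψ (Y l * (totalNumberOp - (N : ℂ) •
            (1 : Matrix (Finset (Orb Λ)) (Finset (Orb Λ)) ℂ))) = 0 :=
          vectorState_mul_of_mulVec_eq_zero ψ (Y l) hZ
        have e2 : vectorState ψ ((totalNumberOp - (N : ℂ) •
            (1 : Matrix (Finset (Orb Λ)) (Finset (Orb Λ)) ℂ)) * Y' l) = 0 :=
          vectorState_mul_of_conjTranspose_mulVec_eq_zero ψ (Y' l) hZ'
        rw [map_add, hω, e1, e2, add_zero]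
    have h3 : ∀ j ∈ u, ω (b j • ladderWord (cw j)) = 0 := fun j hj => by
      rw [map_smul, hω, vectorState_apply, smul_eq_mul]
      rcases hcw j hj with hq | hq
      · rw [star_dotProduct_ladderWord_mulVec_eq_zero hψN (cw j) hq, mul_zero]
      · rw [star_dotProduct_ladderWord_mulVec_eq_zero_of_spinCharge hSψ (cw j) hq, mul_zero]
    have h4 : ∀ i ∈ sv,
        ω (V i * spinPlus + Literature.MathematicalPhysics.QuantumLattice.spinMinus * V' i) = 0 :=
      fun i _ => by
        have e1 : vectorState ψ (V i * spinPlus) = 0 := vectorState_mul_of_mulVec_eq_zero ψ (V i) hP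
        have e2 : vectorState ψ (Literature.MathematicalPhysics.QuantumLattice.spinMinus * V' i) = 0 :=
          vectorState_mul_of_conjTranspose_mulVec_eq_zero ψ (V' i) hP'
        rw [map_add, hω, e1, e2, add_zero]
    have h5 : ∀ i ∈ sw,
        ω (W i * Literature.MathematicalPhysics.QuantumLattice.spinMinus + spinPlus * W' i) = 0 :=
      fun i _ => by
        have e1 : vectorState ψ (W i * Literature.MathematicalPhysics.QuantumLattice.spinMinus) = 0 :=
          vectorState_mul_of_mulVec_eq_zero ψ (W i) hM
        have e2 : vectorState ψ (spinPlus * W' i) = 0 :=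
          vectorState_mul_of_conjTranspose_mulVec_eq_zero ψ (W' i) hM'
        rw [map_add, hω, e1, e2, add_zero]
    rw [Finset.sum_eq_zero h1, Finset.sum_eq_zero h2, Finset.sum_eq_zero h3, Finset.sum_eq_zero h4,
      Finset.sum_eq_zero h5]
    simp only [add_zero]
  have hr : -(∑ k ∈ w, ‖a k‖) ≤ (ω (∑ k ∈ w, a k • ladderWord (word k))).re :=
    neg_sum_norm_le_re_map_sum w ω a (fun k => ladderWord (word k)) fun k _ => by
      have h := (isContraction_prod_ladder (word k)).neg_norm_mul_le (a k) ψ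
      rw [hψ1, Complex.one_re, mul_one] at h
      rw [hω, vectorState_apply, ladderWord_eq_prod]
      exact h
  have h := le_re_map_of_certificate_residual ω hpos hone hΛ O hnull hr hcert
  rw [hω, vectorState_apply, hHψ, dotProduct_smul, hψ1, smul_eq_mul, mul_one, Complex.ofReal_re] at h
  have hE : groundEnergyAt G t U (2 * n) =
      (hamiltonian G t U).minEnergyOn (szSector (n + n) (((n : ℝ) - n) / 2)) := by
    rw [groundEnergyAt_eq_minEnergyOn_szSector G t U (by omega), two_mul, sub_self, zero_div]
  rw [hE]
  exact h

/-! ### The even square torus -/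

section Torus

open Literature.Probability.LatticeModels

variable {L : ℕ} [NeZero L]

omit [NeZero L] in
/-- `|(ℤ/Lℤ)²| = L²`. [folklore] -/
private theorem card_fermionTorus_two_hw : Fintype.card (FermionTorus 2 L) = L ^ 2 := by
  simp only [FermionTorus, Fintype.card_lex, Fintype.card_fun, Fintype.card_fin]

/-- **Sector-mode certificate with highest-weight rows on the even square torus**: for even
`L ≠ 0`, `t ≠ 0`, `U > 0`, a sector `(N↑, N↓) = (p, q)` with `p + q = L²`, `q ≤ p` (`S^z = M ≥ 0`),
an identity as in `hubbard_halfFilled_minEnergyOn_szSector_ge_of_certificate_hw` for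
`hamiltonian (fermionTorusGraph 2 L) t U` proves
`c − Σₖ ‖aₖ‖ ≤ E(p, q) = H.minEnergyOn (szSector (p + q) ((p - q)/2))`. Han 2020 §2; Tasaki 1998 §5.
[cite: Han2020Bootstrap, §2] -/
theorem hubbardTorus_minEnergyOn_szSector_ge_of_certificate_hw (hL : Even L) {t U : ℝ} (ht : t ≠ 0)
    (hU : 0 < U) {p q : ℕ} (hpq : p + q = L ^ 2) (hqp : q ≤ p)
    {m : Type*} [Fintype m] [DecidableEq m] {Λm : Matrix m m ℂ} (hΛ : Λm.PosSemidef)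
    (O : m → Matrix (Finset (Orb (FermionTorus 2 L))) (Finset (Orb (FermionTorus 2 L))) ℂ)
    {κ : Type*} (s : Finset κ)
    (X : κ → Matrix (Finset (Orb (FermionTorus 2 L))) (Finset (Orb (FermionTorus 2 L))) ℂ)
    {κ' : Type*} (s' : Finset κ')
    (Y Y' : κ' → Matrix (Finset (Orb (FermionTorus 2 L))) (Finset (Orb (FermionTorus 2 L))) ℂ)
    {ρ : Type*} (u : Finset ρ) (b : ρ → ℂ) (cw : ρ → List (Orb (FermionTorus 2 L) × Bool))
    (hcw : ∀ j ∈ u, ladderCharge (cw j) ≠ 0 ∨ ladderSpinCharge (cw j) ≠ 0)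
    {ν : Type*} (sv : Finset ν)
    (V V' : ν → Matrix (Finset (Orb (FermionTorus 2 L))) (Finset (Orb (FermionTorus 2 L))) ℂ)
    {κ'' : Type*} (w : Finset κ'') (a : κ'' → ℂ) (word : κ'' → List (Orb (FermionTorus 2 L) × Bool))
    {c : ℝ}
    (hcert : hamiltonian (fermionTorusGraph 2 L) t U -
        (c : ℂ) • (1 : Matrix (Finset (Orb (FermionTorus 2 L))) (Finset (Orb (FermionTorus 2 L))) ℂ) =
      gramForm Λm O +
        (((∑ k ∈ s, (hamiltonian (fermionTorusGraph 2 L) t U * X k -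
            X k * hamiltonian (fermionTorusGraph 2 L) t U) +
          ∑ l ∈ s', (Y l * (totalNumberOp - ((p + q : ℕ) : ℂ) • 1) +
            (totalNumberOp - ((p + q : ℕ) : ℂ) • 1) * Y' l)) +
          ∑ j ∈ u, b j • ladderWord (cw j)) +
          ∑ i ∈ sv, (V i * spinPlus + Literature.MathematicalPhysics.QuantumLattice.spinMinus * V' i)) +
        ∑ k ∈ w, a k • ladderWord (word k)) :
    c - ∑ k ∈ w, ‖a k‖ ≤
      (hamiltonian (fermionTorusGraph 2 L) t U).minEnergyOn (szSector (p + q) (((p : ℝ) - q) / 2)) := by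
  obtain ⟨hG, hA, h2, -⟩ := LiebHalfFilled.hubbardTorus_lieb_hypotheses (L := L) hL
  have hcard := LiebHalfFilled.compl_card_eq_card_of_two_mul h2
  rw [card_fermionTorus_two_hw] at h2
  have h := hubbard_halfFilled_minEnergyOn_szSector_ge_of_certificate_hw (fermionTorusGraph 2 L) hG _ hA
    ht hU (p := p) (q := q) (by rw [card_fermionTorus_two_hw]; omega) (by omega) (by omega)
    hΛ O s X s' Y Y' u b cw hcw sv V V' w a word (c := c) (by convert hcert)
  convert h using 4

/-- **Certificate with singlet rows for the half-filled even square torus**: for even `L ≠ 0`,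
`t ≠ 0`, `U > 0`, an identity as in `hubbard_halfFilled_groundEnergyAt_ge_of_certificate_singlet`
(both families `Σᵢ (Vᵢ S⁺ + S⁻ V'ᵢ)` and `Σᵢ (Wᵢ S⁻ + S⁺ W'ᵢ)`, number-ideal terms at `N = L²`) for
`hamiltonian (fermionTorusGraph 2 L) t U` proves `c − Σₖ ‖aₖ‖ ≤ E₀(L²) = groundEnergyAt _ t U (L²)`
— the soundness edge of certsdp's `Σ S⁺` / `Σ S⁻` `ideal_ops` under the licence "Lieb 1989 Thm 2"
on the `L × L` torus. Han 2020 §2; Lieb 1989 Theorem 2. [cite: Han2020Bootstrap, §2] -/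
theorem hubbardTorus_groundEnergyAt_ge_of_certificate_singlet (hL : Even L) {t U : ℝ} (ht : t ≠ 0)
    (hU : 0 < U)
    {m : Type*} [Fintype m] [DecidableEq m] {Λm : Matrix m m ℂ} (hΛ : Λm.PosSemidef)
    (O : m → Matrix (Finset (Orb (FermionTorus 2 L))) (Finset (Orb (FermionTorus 2 L))) ℂ)
    {κ : Type*} (s : Finset κ)
    (X : κ → Matrix (Finset (Orb (FermionTorus 2 L))) (Finset (Orb (FermionTorus 2 L))) ℂ)
    {κ' : Type*} (s' : Finset κ')
    (Y Y' : κ' → Matrix (Finset (Orb (FermionTorus 2 L))) (Finset (Orb (FermionTorus 2 L))) ℂ)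
    {ρ : Type*} (u : Finset ρ) (b : ρ → ℂ) (cw : ρ → List (Orb (FermionTorus 2 L) × Bool))
    (hcw : ∀ j ∈ u, ladderCharge (cw j) ≠ 0 ∨ ladderSpinCharge (cw j) ≠ 0)
    {ν : Type*} (sv : Finset ν)
    (V V' : ν → Matrix (Finset (Orb (FermionTorus 2 L))) (Finset (Orb (FermionTorus 2 L))) ℂ)
    {ν' : Type*} (sw : Finset ν')
    (W W' : ν' → Matrix (Finset (Orb (FermionTorus 2 L))) (Finset (Orb (FermionTorus 2 L))) ℂ)
    {κ'' : Type*} (w : Finset κ'') (a : κ'' → ℂ) (word : κ'' → List (Orb (FermionTorus 2 L) × Bool))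
    {c : ℝ}
    (hcert : hamiltonian (fermionTorusGraph 2 L) t U -
        (c : ℂ) • (1 : Matrix (Finset (Orb (FermionTorus 2 L))) (Finset (Orb (FermionTorus 2 L))) ℂ) =
      gramForm Λm O +
        (((∑ k ∈ s, (hamiltonian (fermionTorusGraph 2 L) t U * X k -
            X k * hamiltonian (fermionTorusGraph 2 L) t U) +
          ∑ l ∈ s', (Y l * (totalNumberOp - ((L ^ 2 : ℕ) : ℂ) • 1) +
            (totalNumberOp - ((L ^ 2 : ℕ) : ℂ) • 1) * Y' l)) +
          ∑ j ∈ u, b j • ladderWord (cw j)) +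
          (∑ i ∈ sv, (V i * spinPlus + Literature.MathematicalPhysics.QuantumLattice.spinMinus * V' i) +
           ∑ i ∈ sw, (W i * Literature.MathematicalPhysics.QuantumLattice.spinMinus + spinPlus * W' i))) +
        ∑ k ∈ w, a k • ladderWord (word k)) :
    c - ∑ k ∈ w, ‖a k‖ ≤ groundEnergyAt (fermionTorusGraph 2 L) t U (L ^ 2) := by
  obtain ⟨hG, hA, h2, -⟩ := LiebHalfFilled.hubbardTorus_lieb_hypotheses (L := L) hL
  have hcard := LiebHalfFilled.compl_card_eq_card_of_two_mul h2
  rw [card_fermionTorus_two_hw] at h2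
  set n := (Finset.univ.filter fun x : FermionTorus 2 L => torusStagger x = 1).card with hn
  have e : n + n = L ^ 2 := by omega
  have h := hubbard_halfFilled_groundEnergyAt_ge_of_certificate_singlet (fermionTorusGraph 2 L) hG _ hA
    ht hU (n := n) (by rw [card_fermionTorus_two_hw]; omega) le_rfl (by rw [hcard])
    hΛ O s X s' Y Y' u b cw hcw sv V V' sw W W' w a word (c := c) (by rw [e]; convert hcert)
  rw [show 2 * n = L ^ 2 by omega] at h
  convert h using 4

end Torus

/-! ### Singlet rows in energy-constrained correlator certificates -/

section Correlator

/-- **Singlet rows in a sector correlator certificate (identity level).** For a unit `N`-particle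
vector `ψ` with `H ψ = E₀(N) ψ`, `S^z ψ = q ψ` and `S⁺ ψ = S⁻ ψ = 0`, an identity
`X − c·1 − κ (u·1 − H) = Σ Λᵢⱼ Oᵢᴴ Oⱼ + ((Σₖ (H Xₖ − Xₖ H) + Σₗ (Yₗ (N̂ − N) + (N̂ − N) Y'ₗ)) + Σⱼ bⱼ wⱼ)
  + (Σᵢ (Vᵢ S⁺ + S⁻ V'ᵢ) + Σᵢ (Wᵢ S⁻ + S⁺ W'ᵢ)) + (Σₘ dₘ (Uₘᴴ − Uₘ) + Σₖ aₖ vₖ)`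
(`Λ ⪰ 0`, charged words `wⱼ`, real `dₘ`, ladder words `vₖ`) yields
`c − Σₖ ‖aₖ‖ + κ (u − E₀(N)) ≤ Re ⟨ψ, X ψ⟩`: the singlet rows are folded into the objective
(`⟨ψ, (Vᵢ S⁺ + S⁻ V'ᵢ) ψ⟩ = 0`), and the tree's `re_dotProduct_ge_of_sector_certificate_ineq`
applies to `X − (singlet rows)`. Wang et al. 2024 §3 eq. (obsopt); Han 2020 §2.
[cite: WangEtAl2024, §3 eq. (obsopt)] -/
theorem re_dotProduct_ge_of_sector_certificate_singlet (t U : ℝ) {N : ℕ}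
    {ψ : Fock (Orb Λ)} (hψN : IsNParticle N ψ) (hψ1 : star ψ ⬝ᵥ ψ = 1)
    (hHψ : hamiltonian G t U *ᵥ ψ = ((groundEnergyAt G t U N : ℝ) : ℂ) • ψ)
    {q : ℝ} (hSψ : HubbardWave0.spinZ *ᵥ ψ = (q : ℂ) • ψ)
    (hP : spinPlus *ᵥ ψ = 0) (hM : Literature.MathematicalPhysics.QuantumLattice.spinMinus *ᵥ ψ = 0)
    (X : Matrix (Finset (Orb Λ)) (Finset (Orb Λ)) ℂ) (κ u : ℝ)
    {m : Type*} [Fintype m] [DecidableEq m] {Λm : Matrix m m ℂ} (hΛ : Λm.PosSemidef)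
    (O : m → Matrix (Finset (Orb Λ)) (Finset (Orb Λ)) ℂ)
    {κ₁ : Type*} (s : Finset κ₁) (Xc : κ₁ → Matrix (Finset (Orb Λ)) (Finset (Orb Λ)) ℂ)
    {κ₂ : Type*} (s' : Finset κ₂) (Y Y' : κ₂ → Matrix (Finset (Orb Λ)) (Finset (Orb Λ)) ℂ)
    {ρ : Type*} (uc : Finset ρ) (b : ρ → ℂ) (cw : ρ → List (Orb Λ × Bool))
    (hcw : ∀ j ∈ uc, ladderCharge (cw j) ≠ 0 ∨ ladderSpinCharge (cw j) ≠ 0)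
    {ν : Type*} (sv : Finset ν) (V₁ V₁' : ν → Matrix (Finset (Orb Λ)) (Finset (Orb Λ)) ℂ)
    {ν' : Type*} (sw : Finset ν') (W W' : ν' → Matrix (Finset (Orb Λ)) (Finset (Orb Λ)) ℂ)
    {δ : Type*} (ah : Finset δ) (dc : δ → ℝ) (V : δ → Matrix (Finset (Orb Λ)) (Finset (Orb Λ)) ℂ)
    {κ₃ : Type*} (w : Finset κ₃) (a : κ₃ → ℂ) (word : κ₃ → List (Orb Λ × Bool)) {c : ℝ}
    (hcert : X - (c : ℂ) • (1 : Matrix (Finset (Orb Λ)) (Finset (Orb Λ)) ℂ) -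
        ((κ : ℝ) : ℂ) • (((u : ℝ) : ℂ) • (1 : Matrix (Finset (Orb Λ)) (Finset (Orb Λ)) ℂ) -
          hamiltonian G t U) =
      gramForm Λm O +
        ((∑ k ∈ s, (hamiltonian G t U * Xc k - Xc k * hamiltonian G t U) +
          ∑ l ∈ s', (Y l * (totalNumberOp - (N : ℂ) • 1) + (totalNumberOp - (N : ℂ) • 1) * Y' l)) +
          ∑ j ∈ uc, b j • ladderWord (cw j)) +
        (∑ i ∈ sv, (V₁ i * spinPlus + Literature.MathematicalPhysics.QuantumLattice.spinMinus * V₁' i) +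
          ∑ i ∈ sw, (W i * Literature.MathematicalPhysics.QuantumLattice.spinMinus + spinPlus * W' i)) +
        (∑ m' ∈ ah, ((dc m' : ℝ) : ℂ) • ((V m')ᴴ - V m') + ∑ k ∈ w, a k • ladderWord (word k))) :
    c - ∑ k ∈ w, ‖a k‖ + κ * (u - groundEnergyAt G t U N) ≤ (star ψ ⬝ᵥ X *ᵥ ψ).re := by
  -- fold the singlet rows into the objective
  set Sg : Matrix (Finset (Orb Λ)) (Finset (Orb Λ)) ℂ :=
    ∑ i ∈ sv, (V₁ i * spinPlus + Literature.MathematicalPhysics.QuantumLattice.spinMinus * V₁' i) +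
      ∑ i ∈ sw, (W i * Literature.MathematicalPhysics.QuantumLattice.spinMinus + spinPlus * W' i)
    with hSg
  have hcert' : (X - Sg) - (c : ℂ) • (1 : Matrix (Finset (Orb Λ)) (Finset (Orb Λ)) ℂ) -
        ((κ : ℝ) : ℂ) • (((u : ℝ) : ℂ) • (1 : Matrix (Finset (Orb Λ)) (Finset (Orb Λ)) ℂ) -
          hamiltonian G t U) =
      gramForm Λm O +
        ((∑ k ∈ s, (hamiltonian G t U * Xc k - Xc k * hamiltonian G t U) +
          ∑ l ∈ s', (Y l * (totalNumberOp - (N : ℂ) • 1) + (totalNumberOp - (N : ℂ) • 1) * Y' l)) +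
          ∑ j ∈ uc, b j • ladderWord (cw j)) +
        (∑ m' ∈ ah, ((dc m' : ℝ) : ℂ) • ((V m')ᴴ - V m') + ∑ k ∈ w, a k • ladderWord (word k)) := by
    have e : (X - Sg) - (c : ℂ) • (1 : Matrix (Finset (Orb Λ)) (Finset (Orb Λ)) ℂ) -
        ((κ : ℝ) : ℂ) • (((u : ℝ) : ℂ) • (1 : Matrix (Finset (Orb Λ)) (Finset (Orb Λ)) ℂ) -
          hamiltonian G t U) =
        (X - (c : ℂ) • (1 : Matrix (Finset (Orb Λ)) (Finset (Orb Λ)) ℂ) -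
          ((κ : ℝ) : ℂ) • (((u : ℝ) : ℂ) • (1 : Matrix (Finset (Orb Λ)) (Finset (Orb Λ)) ℂ) -
            hamiltonian G t U)) - Sg := by abel
    rw [e, hcert, hSg]; abel
  have h := re_dotProduct_ge_of_sector_certificate_ineq G t U hψN hψ1 hHψ hSψ (X - Sg) κ u hΛ O s Xc
    s' Y Y' uc b cw hcw ah dc V w a word hcert'
  -- the singlet rows have zero expectation in `ψ`
  set ω := vectorState ψ with hω
  have hP' : (Literature.MathematicalPhysics.QuantumLattice.spinMinus :
      Matrix (Finset (Orb Λ)) (Finset (Orb Λ)) ℂ)ᴴ *ᵥ ψ = 0 := by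
    rw [Literature.MathematicalPhysics.QuantumLattice.spinMinus, conjTranspose_conjTranspose]
    exact hP
  have hM' : (spinPlus : Matrix (Finset (Orb Λ)) (Finset (Orb Λ)) ℂ)ᴴ *ᵥ ψ = 0 := hM
  have hSg0 : ω Sg = 0 := by
    rw [hSg, map_add, map_sum, map_sum]
    have h4 : ∀ i ∈ sv,
        ω (V₁ i * spinPlus + Literature.MathematicalPhysics.QuantumLattice.spinMinus * V₁' i) = 0 :=
      fun i _ => by
        have e1 : vectorState ψ (V₁ i * spinPlus) = 0 := vectorState_mul_of_mulVec_eq_zero ψ (V₁ i) hP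
        have e2 : vectorState ψ (Literature.MathematicalPhysics.QuantumLattice.spinMinus * V₁' i) = 0 :=
          vectorState_mul_of_conjTranspose_mulVec_eq_zero ψ (V₁' i) hP'
        rw [map_add, hω, e1, e2, add_zero]
    have h5 : ∀ i ∈ sw,
        ω (W i * Literature.MathematicalPhysics.QuantumLattice.spinMinus + spinPlus * W' i) = 0 :=
      fun i _ => by
        have e1 : vectorState ψ (W i * Literature.MathematicalPhysics.QuantumLattice.spinMinus) = 0 :=
          vectorState_mul_of_mulVec_eq_zero ψ (W i) hM
        have e2 : vectorState ψ (spinPlus * W' i) = 0 :=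
          vectorState_mul_of_conjTranspose_mulVec_eq_zero ψ (W' i) hM'
        rw [map_add, hω, e1, e2, add_zero]
    rw [Finset.sum_eq_zero h4, Finset.sum_eq_zero h5, add_zero]
  have hX : star ψ ⬝ᵥ (X - Sg) *ᵥ ψ = star ψ ⬝ᵥ X *ᵥ ψ := by
    have h0 : star ψ ⬝ᵥ Sg *ᵥ ψ = 0 := by
      have := hSg0
      rwa [hω, vectorState_apply] at this
    rw [sub_mulVec, dotProduct_sub, h0, sub_zero]
  rw [hX] at h
  exact h

variable {L : ℕ} [NeZero L]

open Literature.Probability.LatticeModels in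
/-- **Half-filled even square torus: correlator certificates with singlet rows bound EVERY ground
state.** On `(ℤ/Lℤ)²` with `L` even, `t ≠ 0`, `U > 0`, the `L²`-particle ground state is unique and a
singlet (Lieb 1989 Theorem 2; tree `LiebHalfFilled.hubbardTorus_exists_unit_groundState`), so
`S⁺ψ = S⁻ψ = 0` for every ground vector `ψ`; hence an energy-constrained sector certificate
(`E₀(L²) ≤ u`, `κ ≥ 0`) whose null part also contains the singlet rows
`Σᵢ (Vᵢ S⁺ + S⁻ V'ᵢ) + Σᵢ (Wᵢ S⁻ + S⁺ W'ᵢ)` yields `c − Σₖ ‖aₖ‖ ≤ Re ⟨ψ, X ψ⟩` for every unit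
`L²`-particle ground vector `ψ`. Wang et al. 2024 §3 eq. (obsopt); Han 2020 §2; Lieb 1989.
[cite: WangEtAl2024, §3 eq. (obsopt)] -/
theorem hubbardTorus_groundState_re_dotProduct_ge_of_sector_certificate_singlet (hL : Even L)
    {t U : ℝ} (ht : t ≠ 0) (hU : 0 < U)
    {ψ : Fock (Orb (FermionTorus 2 L))} (hψN : IsNParticle (L ^ 2) ψ) (hψ1 : star ψ ⬝ᵥ ψ = 1)
    (hHψ : hamiltonian (fermionTorusGraph 2 L) t U *ᵥ ψ =
      ((groundEnergyAt (fermionTorusGraph 2 L) t U (L ^ 2) : ℝ) : ℂ) • ψ)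
    (X : Matrix (Finset (Orb (FermionTorus 2 L))) (Finset (Orb (FermionTorus 2 L))) ℂ)
    {κ u : ℝ} (hκ : 0 ≤ κ) (hu : groundEnergyAt (fermionTorusGraph 2 L) t U (L ^ 2) ≤ u)
    {m : Type*} [Fintype m] [DecidableEq m] {Λm : Matrix m m ℂ} (hΛ : Λm.PosSemidef)
    (O : m → Matrix (Finset (Orb (FermionTorus 2 L))) (Finset (Orb (FermionTorus 2 L))) ℂ)
    {κ₁ : Type*} (s : Finset κ₁)
    (Xc : κ₁ → Matrix (Finset (Orb (FermionTorus 2 L))) (Finset (Orb (FermionTorus 2 L))) ℂ)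
    {κ₂ : Type*} (s' : Finset κ₂)
    (Y Y' : κ₂ → Matrix (Finset (Orb (FermionTorus 2 L))) (Finset (Orb (FermionTorus 2 L))) ℂ)
    {ρ : Type*} (uc : Finset ρ) (b : ρ → ℂ) (cw : ρ → List (Orb (FermionTorus 2 L) × Bool))
    (hcw : ∀ j ∈ uc, ladderCharge (cw j) ≠ 0 ∨ ladderSpinCharge (cw j) ≠ 0)
    {ν : Type*} (sv : Finset ν)
    (V₁ V₁' : ν → Matrix (Finset (Orb (FermionTorus 2 L))) (Finset (Orb (FermionTorus 2 L))) ℂ)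
    {ν' : Type*} (sw : Finset ν')
    (W W' : ν' → Matrix (Finset (Orb (FermionTorus 2 L))) (Finset (Orb (FermionTorus 2 L))) ℂ)
    {δ : Type*} (ah : Finset δ) (dc : δ → ℝ)
    (V : δ → Matrix (Finset (Orb (FermionTorus 2 L))) (Finset (Orb (FermionTorus 2 L))) ℂ)
    {κ₃ : Type*} (w : Finset κ₃) (a : κ₃ → ℂ) (word : κ₃ → List (Orb (FermionTorus 2 L) × Bool))
    {c : ℝ}
    (hcert : X - (c : ℂ) • (1 : Matrix (Finset (Orb (FermionTorus 2 L))) (Finset (Orb (FermionTorus 2 L))) ℂ) -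
        ((κ : ℝ) : ℂ) • (((u : ℝ) : ℂ) •
          (1 : Matrix (Finset (Orb (FermionTorus 2 L))) (Finset (Orb (FermionTorus 2 L))) ℂ) -
          hamiltonian (fermionTorusGraph 2 L) t U) =
      gramForm Λm O +
        ((∑ k ∈ s, (hamiltonian (fermionTorusGraph 2 L) t U * Xc k -
            Xc k * hamiltonian (fermionTorusGraph 2 L) t U) +
          ∑ l ∈ s', (Y l * (totalNumberOp - ((L ^ 2 : ℕ) : ℂ) • 1) +
            (totalNumberOp - ((L ^ 2 : ℕ) : ℂ) • 1) * Y' l)) +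
          ∑ j ∈ uc, b j • ladderWord (cw j)) +
        (∑ i ∈ sv, (V₁ i * spinPlus + Literature.MathematicalPhysics.QuantumLattice.spinMinus * V₁' i) +
          ∑ i ∈ sw, (W i * Literature.MathematicalPhysics.QuantumLattice.spinMinus + spinPlus * W' i)) +
        (∑ m' ∈ ah, ((dc m' : ℝ) : ℂ) • ((V m')ᴴ - V m') + ∑ k ∈ w, a k • ladderWord (word k))) :
    c - ∑ k ∈ w, ‖a k‖ ≤ (star ψ ⬝ᵥ X *ᵥ ψ).re := by
  obtain ⟨φ, -, -, -, hS2φ, huniq, -⟩ :=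
    LiebHalfFilled.hubbardTorus_exists_unit_groundState (L := L) hL ht hU
  -- `ψ` is a multiple of the singlet `φ`
  have hψφ : ψ = (star φ ⬝ᵥ ψ) • φ := huniq ψ hψN hHψ
  have hS2 : spinSq *ᵥ ψ = 0 := by
    rw [hψφ, mulVec_smul, hS2φ, smul_zero]
  obtain ⟨hP, hM, hZ⟩ := spin_mulVec_eq_zero_of_spinSq_mulVec_eq_zero hS2
  have hSψ : HubbardWave0.spinZ *ᵥ ψ = ((0 : ℝ) : ℂ) • ψ := by
    rw [hZ, Complex.ofReal_zero, zero_smul]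
  have h := re_dotProduct_ge_of_sector_certificate_singlet (fermionTorusGraph 2 L) t U hψN hψ1 hHψ
    hSψ hP hM X κ u hΛ O s Xc s' Y Y' uc b cw hcw sv V₁ V₁' sw W W' ah dc V w a word (c := c)
    (by convert hcert)
  nlinarith [mul_nonneg hκ (sub_nonneg.2 hu)]

end Correlator

/-! ### General annihilator rows: spin singlet and pseudospin singlet (`S^±`, `η_ε`, `η†_ε`) -/

section Annihilators

/-- **Annihilator rows in a sector correlator certificate (identity level).** For a unit
`N`-particle vector `ψ` with `H ψ = E₀(N) ψ`, `S^z ψ = q ψ`, and a finite family of matrices `Gᵢ`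
with `Gᵢ ψ = 0`, an identity
`X − c·1 − κ (u·1 − H) = Σ Λᵢⱼ Oᵢᴴ Oⱼ + ((Σₖ (H Xₖ − Xₖ H) + Σₗ (Yₗ (N̂ − N) + (N̂ − N) Y'ₗ)) + Σⱼ bⱼ wⱼ)
  + Σᵢ (Rᵢ Gᵢ + Gᵢᴴ R'ᵢ) + (Σₘ dₘ (Vₘᴴ − Vₘ) + Σₖ aₖ vₖ)`
yields `c − Σₖ ‖aₖ‖ + κ (u − E₀(N)) ≤ Re ⟨ψ, X ψ⟩` (`⟨ψ, Rᵢ Gᵢ ψ⟩ = 0`, `⟨ψ, Gᵢᴴ R'ᵢ ψ⟩ =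
⟨Gᵢ ψ, R'ᵢ ψ⟩ = 0`; fold the rows into the objective and apply
`re_dotProduct_ge_of_sector_certificate_ineq`). Han 2020 §2; Wang et al. 2024 §3 eq. (obsopt).
[cite: Han2020Bootstrap, §2] -/
theorem re_dotProduct_ge_of_sector_certificate_annihilators (t U : ℝ) {N : ℕ}
    {ψ : Fock (Orb Λ)} (hψN : IsNParticle N ψ) (hψ1 : star ψ ⬝ᵥ ψ = 1)
    (hHψ : hamiltonian G t U *ᵥ ψ = ((groundEnergyAt G t U N : ℝ) : ℂ) • ψ)
    {q : ℝ} (hSψ : HubbardWave0.spinZ *ᵥ ψ = (q : ℂ) • ψ)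
    {ζ : Type*} (sz : Finset ζ) (Gn : ζ → Matrix (Finset (Orb Λ)) (Finset (Orb Λ)) ℂ)
    (hGn : ∀ i ∈ sz, Gn i *ᵥ ψ = 0) (R R' : ζ → Matrix (Finset (Orb Λ)) (Finset (Orb Λ)) ℂ)
    (X : Matrix (Finset (Orb Λ)) (Finset (Orb Λ)) ℂ) (κ u : ℝ)
    {m : Type*} [Fintype m] [DecidableEq m] {Λm : Matrix m m ℂ} (hΛ : Λm.PosSemidef)
    (O : m → Matrix (Finset (Orb Λ)) (Finset (Orb Λ)) ℂ)
    {κ₁ : Type*} (s : Finset κ₁) (Xc : κ₁ → Matrix (Finset (Orb Λ)) (Finset (Orb Λ)) ℂ)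
    {κ₂ : Type*} (s' : Finset κ₂) (Y Y' : κ₂ → Matrix (Finset (Orb Λ)) (Finset (Orb Λ)) ℂ)
    {ρ : Type*} (uc : Finset ρ) (b : ρ → ℂ) (cw : ρ → List (Orb Λ × Bool))
    (hcw : ∀ j ∈ uc, ladderCharge (cw j) ≠ 0 ∨ ladderSpinCharge (cw j) ≠ 0)
    {δ : Type*} (ah : Finset δ) (dc : δ → ℝ) (V : δ → Matrix (Finset (Orb Λ)) (Finset (Orb Λ)) ℂ)
    {κ₃ : Type*} (w : Finset κ₃) (a : κ₃ → ℂ) (word : κ₃ → List (Orb Λ × Bool)) {c : ℝ}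
    (hcert : X - (c : ℂ) • (1 : Matrix (Finset (Orb Λ)) (Finset (Orb Λ)) ℂ) -
        ((κ : ℝ) : ℂ) • (((u : ℝ) : ℂ) • (1 : Matrix (Finset (Orb Λ)) (Finset (Orb Λ)) ℂ) -
          hamiltonian G t U) =
      gramForm Λm O +
        ((∑ k ∈ s, (hamiltonian G t U * Xc k - Xc k * hamiltonian G t U) +
          ∑ l ∈ s', (Y l * (totalNumberOp - (N : ℂ) • 1) + (totalNumberOp - (N : ℂ) • 1) * Y' l)) +
          ∑ j ∈ uc, b j • ladderWord (cw j)) +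
        ∑ i ∈ sz, (R i * Gn i + (Gn i)ᴴ * R' i) +
        (∑ m' ∈ ah, ((dc m' : ℝ) : ℂ) • ((V m')ᴴ - V m') + ∑ k ∈ w, a k • ladderWord (word k))) :
    c - ∑ k ∈ w, ‖a k‖ + κ * (u - groundEnergyAt G t U N) ≤ (star ψ ⬝ᵥ X *ᵥ ψ).re := by
  set Sg : Matrix (Finset (Orb Λ)) (Finset (Orb Λ)) ℂ := ∑ i ∈ sz, (R i * Gn i + (Gn i)ᴴ * R' i)
    with hSg
  have hcert' : (X - Sg) - (c : ℂ) • (1 : Matrix (Finset (Orb Λ)) (Finset (Orb Λ)) ℂ) -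
        ((κ : ℝ) : ℂ) • (((u : ℝ) : ℂ) • (1 : Matrix (Finset (Orb Λ)) (Finset (Orb Λ)) ℂ) -
          hamiltonian G t U) =
      gramForm Λm O +
        ((∑ k ∈ s, (hamiltonian G t U * Xc k - Xc k * hamiltonian G t U) +
          ∑ l ∈ s', (Y l * (totalNumberOp - (N : ℂ) • 1) + (totalNumberOp - (N : ℂ) • 1) * Y' l)) +
          ∑ j ∈ uc, b j • ladderWord (cw j)) +
        (∑ m' ∈ ah, ((dc m' : ℝ) : ℂ) • ((V m')ᴴ - V m') + ∑ k ∈ w, a k • ladderWord (word k)) := by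
    have e : (X - Sg) - (c : ℂ) • (1 : Matrix (Finset (Orb Λ)) (Finset (Orb Λ)) ℂ) -
        ((κ : ℝ) : ℂ) • (((u : ℝ) : ℂ) • (1 : Matrix (Finset (Orb Λ)) (Finset (Orb Λ)) ℂ) -
          hamiltonian G t U) =
        (X - (c : ℂ) • (1 : Matrix (Finset (Orb Λ)) (Finset (Orb Λ)) ℂ) -
          ((κ : ℝ) : ℂ) • (((u : ℝ) : ℂ) • (1 : Matrix (Finset (Orb Λ)) (Finset (Orb Λ)) ℂ) -
            hamiltonian G t U)) - Sg := by abel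
    rw [e, hcert, hSg]; abel
  have h := re_dotProduct_ge_of_sector_certificate_ineq G t U hψN hψ1 hHψ hSψ (X - Sg) κ u hΛ O s Xc
    s' Y Y' uc b cw hcw ah dc V w a word hcert'
  set ω := vectorState ψ with hω
  have hSg0 : ω Sg = 0 := by
    rw [hSg, map_sum]
    refine Finset.sum_eq_zero fun i hi => ?_
    have hG' : ((Gn i)ᴴ)ᴴ *ᵥ ψ = 0 := by rw [conjTranspose_conjTranspose]; exact hGn i hi
    have e1 : vectorState ψ (R i * Gn i) = 0 := vectorState_mul_of_mulVec_eq_zero ψ (R i) (hGn i hi)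
    have e2 : vectorState ψ ((Gn i)ᴴ * R' i) = 0 :=
      vectorState_mul_of_conjTranspose_mulVec_eq_zero ψ (R' i) hG'
    rw [map_add, hω, e1, e2, add_zero]
  have hX : star ψ ⬝ᵥ (X - Sg) *ᵥ ψ = star ψ ⬝ᵥ X *ᵥ ψ := by
    have h0 : star ψ ⬝ᵥ Sg *ᵥ ψ = 0 := by
      have := hSg0
      rwa [hω, vectorState_apply] at this
    rw [sub_mulVec, dotProduct_sub, h0, sub_zero]
  rw [hX] at h
  exact h

variable {L : ℕ} [NeZero L]

open Literature.Probability.LatticeModels in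
/-- **Half-filled even square torus: annihilator rows for `S⁺, S⁻, η_ε, η†_ε` in correlator
certificates.** On `(ℤ/Lℤ)²` with `L` even, `t ≠ 0`, `U > 0`, every `L²`-particle ground vector
`ψ` is a spin singlet (`S^± ψ = 0`, Lieb 1989 Theorem 2) and a pseudospin singlet (`η_ε ψ = η†_ε ψ
= 0` with Yang's staggering `ε = torusStagger`; tree `hubbardTorus_eta_mulVec_eq_zero`). Hence an
energy-constrained sector certificate (`E₀(L²) ≤ u`, `κ ≥ 0`) whose null part contains rows
`Σᵢ (Rᵢ Gᵢ + Gᵢᴴ R'ᵢ)` with each `Gᵢ ∈ {S⁺, S⁻, η_ε, η†_ε}` yields `c − Σₖ ‖aₖ‖ ≤ Re ⟨ψ, X ψ⟩` for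
every unit `L²`-particle ground vector `ψ`. Han 2020 §2; Wang et al. 2024 §3; Lieb 1989; Yang–Zhang
1990. [cite: Han2020Bootstrap, §2] -/
theorem hubbardTorus_groundState_re_dotProduct_ge_of_sector_certificate_annihilators (hL : Even L)
    {t U : ℝ} (ht : t ≠ 0) (hU : 0 < U)
    {ψ : Fock (Orb (FermionTorus 2 L))} (hψN : IsNParticle (L ^ 2) ψ) (hψ1 : star ψ ⬝ᵥ ψ = 1)
    (hHψ : hamiltonian (fermionTorusGraph 2 L) t U *ᵥ ψ =
      ((groundEnergyAt (fermionTorusGraph 2 L) t U (L ^ 2) : ℝ) : ℂ) • ψ)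
    {ζ : Type*} (sz : Finset ζ)
    (Gn : ζ → Matrix (Finset (Orb (FermionTorus 2 L))) (Finset (Orb (FermionTorus 2 L))) ℂ)
    (hGn : ∀ i ∈ sz, Gn i = spinPlus ∨ Gn i = Literature.MathematicalPhysics.QuantumLattice.spinMinus ∨
      Gn i = etaLower (torusStagger (d := 2) (L := L)) ∨ Gn i = etaRaise (torusStagger (d := 2) (L := L)))
    (R R' : ζ → Matrix (Finset (Orb (FermionTorus 2 L))) (Finset (Orb (FermionTorus 2 L))) ℂ)
    (X : Matrix (Finset (Orb (FermionTorus 2 L))) (Finset (Orb (FermionTorus 2 L))) ℂ)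
    {κ u : ℝ} (hκ : 0 ≤ κ) (hu : groundEnergyAt (fermionTorusGraph 2 L) t U (L ^ 2) ≤ u)
    {m : Type*} [Fintype m] [DecidableEq m] {Λm : Matrix m m ℂ} (hΛ : Λm.PosSemidef)
    (O : m → Matrix (Finset (Orb (FermionTorus 2 L))) (Finset (Orb (FermionTorus 2 L))) ℂ)
    {κ₁ : Type*} (s : Finset κ₁)
    (Xc : κ₁ → Matrix (Finset (Orb (FermionTorus 2 L))) (Finset (Orb (FermionTorus 2 L))) ℂ)
    {κ₂ : Type*} (s' : Finset κ₂)
    (Y Y' : κ₂ → Matrix (Finset (Orb (FermionTorus 2 L))) (Finset (Orb (FermionTorus 2 L))) ℂ)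
    {ρ : Type*} (uc : Finset ρ) (b : ρ → ℂ) (cw : ρ → List (Orb (FermionTorus 2 L) × Bool))
    (hcw : ∀ j ∈ uc, ladderCharge (cw j) ≠ 0 ∨ ladderSpinCharge (cw j) ≠ 0)
    {δ : Type*} (ah : Finset δ) (dc : δ → ℝ)
    (V : δ → Matrix (Finset (Orb (FermionTorus 2 L))) (Finset (Orb (FermionTorus 2 L))) ℂ)
    {κ₃ : Type*} (w : Finset κ₃) (a : κ₃ → ℂ) (word : κ₃ → List (Orb (FermionTorus 2 L) × Bool))
    {c : ℝ}
    (hcert : X - (c : ℂ) • (1 : Matrix (Finset (Orb (FermionTorus 2 L))) (Finset (Orb (FermionTorus 2 L))) ℂ) -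
        ((κ : ℝ) : ℂ) • (((u : ℝ) : ℂ) •
          (1 : Matrix (Finset (Orb (FermionTorus 2 L))) (Finset (Orb (FermionTorus 2 L))) ℂ) -
          hamiltonian (fermionTorusGraph 2 L) t U) =
      gramForm Λm O +
        ((∑ k ∈ s, (hamiltonian (fermionTorusGraph 2 L) t U * Xc k -
            Xc k * hamiltonian (fermionTorusGraph 2 L) t U) +
          ∑ l ∈ s', (Y l * (totalNumberOp - ((L ^ 2 : ℕ) : ℂ) • 1) +
            (totalNumberOp - ((L ^ 2 : ℕ) : ℂ) • 1) * Y' l)) +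
          ∑ j ∈ uc, b j • ladderWord (cw j)) +
        ∑ i ∈ sz, (R i * Gn i + (Gn i)ᴴ * R' i) +
        (∑ m' ∈ ah, ((dc m' : ℝ) : ℂ) • ((V m')ᴴ - V m') + ∑ k ∈ w, a k • ladderWord (word k))) :
    c - ∑ k ∈ w, ‖a k‖ ≤ (star ψ ⬝ᵥ X *ᵥ ψ).re := by
  obtain ⟨φ, -, -, -, hS2φ, huniq, -⟩ :=
    LiebHalfFilled.hubbardTorus_exists_unit_groundState (L := L) hL ht hU
  have hψφ : ψ = (star φ ⬝ᵥ ψ) • φ := huniq ψ hψN hHψ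
  have hS2 : spinSq *ᵥ ψ = 0 := by
    rw [hψφ, mulVec_smul, hS2φ, smul_zero]
  obtain ⟨hP, hM, hZ⟩ := spin_mulVec_eq_zero_of_spinSq_mulVec_eq_zero hS2
  obtain ⟨hE, hE'⟩ := hubbardTorus_eta_mulVec_eq_zero (L := L) hL ht hU hψN hHψ
  have hSψ : HubbardWave0.spinZ *ᵥ ψ = ((0 : ℝ) : ℂ) • ψ := by
    rw [hZ, Complex.ofReal_zero, zero_smul]
  have hGn' : ∀ i ∈ sz, Gn i *ᵥ ψ = 0 := by
    intro i hi
    rcases hGn i hi with h | h | h | h <;> rw [h]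
    exacts [hP, hM, hE, hE']
  have h := re_dotProduct_ge_of_sector_certificate_annihilators (fermionTorusGraph 2 L) t U hψN hψ1
    hHψ hSψ sz Gn hGn' R R' X κ u hΛ O s Xc s' Y Y' uc b cw hcw ah dc V w a word (c := c)
    (by convert hcert)
  nlinarith [mul_nonneg hκ (sub_nonneg.2 hu)]

open Literature.Probability.LatticeModels in
/-- **Half-filled even square torus: ENERGY certificates with annihilator rows for
`S⁺, S⁻, η_ε, η†_ε`.** For even `L ≠ 0`, `t ≠ 0`, `U > 0`: an identity
`H − c·1 = Σ Λᵢⱼ Oᵢᴴ Oⱼ + ((Σₖ (H Xₖ − Xₖ H) + Σₗ (Yₗ (N̂ − L²) + (N̂ − L²) Y'ₗ)) + Σⱼ bⱼ wⱼ)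
  + Σᵢ (Rᵢ Gᵢ + Gᵢᴴ R'ᵢ) + Σₖ aₖ vₖ` with each `Gᵢ ∈ {S⁺, S⁻, η_ε, η†_ε}` proves
`c − Σₖ ‖aₖ‖ ≤ E₀(L²) = groundEnergyAt (fermionTorusGraph 2 L) t U (L²)` (the correlator form with
`X = H`, `κ = 0`, evaluated in the unique ground state). Han 2020 §2; Lieb 1989 Theorem 2;
Yang–Zhang 1990. [cite: Han2020Bootstrap, §2] -/
theorem hubbardTorus_groundEnergyAt_ge_of_certificate_annihilators (hL : Even L) {t U : ℝ}
    (ht : t ≠ 0) (hU : 0 < U)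
    {ζ : Type*} (sz : Finset ζ)
    (Gn : ζ → Matrix (Finset (Orb (FermionTorus 2 L))) (Finset (Orb (FermionTorus 2 L))) ℂ)
    (hGn : ∀ i ∈ sz, Gn i = spinPlus ∨ Gn i = Literature.MathematicalPhysics.QuantumLattice.spinMinus ∨
      Gn i = etaLower (torusStagger (d := 2) (L := L)) ∨ Gn i = etaRaise (torusStagger (d := 2) (L := L)))
    (R R' : ζ → Matrix (Finset (Orb (FermionTorus 2 L))) (Finset (Orb (FermionTorus 2 L))) ℂ)
    {m : Type*} [Fintype m] [DecidableEq m] {Λm : Matrix m m ℂ} (hΛ : Λm.PosSemidef)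
    (O : m → Matrix (Finset (Orb (FermionTorus 2 L))) (Finset (Orb (FermionTorus 2 L))) ℂ)
    {κ₁ : Type*} (s : Finset κ₁)
    (Xc : κ₁ → Matrix (Finset (Orb (FermionTorus 2 L))) (Finset (Orb (FermionTorus 2 L))) ℂ)
    {κ₂ : Type*} (s' : Finset κ₂)
    (Y Y' : κ₂ → Matrix (Finset (Orb (FermionTorus 2 L))) (Finset (Orb (FermionTorus 2 L))) ℂ)
    {ρ : Type*} (uc : Finset ρ) (b : ρ → ℂ) (cw : ρ → List (Orb (FermionTorus 2 L) × Bool))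
    (hcw : ∀ j ∈ uc, ladderCharge (cw j) ≠ 0 ∨ ladderSpinCharge (cw j) ≠ 0)
    {κ₃ : Type*} (w : Finset κ₃) (a : κ₃ → ℂ) (word : κ₃ → List (Orb (FermionTorus 2 L) × Bool))
    {c : ℝ}
    (hcert : hamiltonian (fermionTorusGraph 2 L) t U -
        (c : ℂ) • (1 : Matrix (Finset (Orb (FermionTorus 2 L))) (Finset (Orb (FermionTorus 2 L))) ℂ) =
      gramForm Λm O +
        ((∑ k ∈ s, (hamiltonian (fermionTorusGraph 2 L) t U * Xc k -
            Xc k * hamiltonian (fermionTorusGraph 2 L) t U) +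
          ∑ l ∈ s', (Y l * (totalNumberOp - ((L ^ 2 : ℕ) : ℂ) • 1) +
            (totalNumberOp - ((L ^ 2 : ℕ) : ℂ) • 1) * Y' l)) +
          ∑ j ∈ uc, b j • ladderWord (cw j)) +
        ∑ i ∈ sz, (R i * Gn i + (Gn i)ᴴ * R' i) +
        ∑ k ∈ w, a k • ladderWord (word k)) :
    c - ∑ k ∈ w, ‖a k‖ ≤ groundEnergyAt (fermionTorusGraph 2 L) t U (L ^ 2) := by
  obtain ⟨ψ, hmem, hψ1, hHψ, -, -, -⟩ :=
    LiebHalfFilled.hubbardTorus_exists_unit_groundState (L := L) hL ht hU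
  have hψN : IsNParticle (L ^ 2) ψ := ((mem_szSector_iff _ _ _).1 hmem).1
  set H := hamiltonian (fermionTorusGraph 2 L) t U with hH
  set E₀ := groundEnergyAt (fermionTorusGraph 2 L) t U (L ^ 2) with hE₀
  -- the energy identity is the correlator identity with `X = H`, `κ = 0`, no anti-Hermitian rows
  have hcert' : H - (c : ℂ) • (1 : Matrix (Finset (Orb (FermionTorus 2 L))) (Finset (Orb (FermionTorus 2 L))) ℂ) -
        (((0 : ℝ) : ℝ) : ℂ) • ((((E₀ : ℝ) : ℝ) : ℂ) •
          (1 : Matrix (Finset (Orb (FermionTorus 2 L))) (Finset (Orb (FermionTorus 2 L))) ℂ) - H) =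
      gramForm Λm O +
        ((∑ k ∈ s, (H * Xc k - Xc k * H) +
          ∑ l ∈ s', (Y l * (totalNumberOp - ((L ^ 2 : ℕ) : ℂ) • 1) +
            (totalNumberOp - ((L ^ 2 : ℕ) : ℂ) • 1) * Y' l)) +
          ∑ j ∈ uc, b j • ladderWord (cw j)) +
        ∑ i ∈ sz, (R i * Gn i + (Gn i)ᴴ * R' i) +
        (∑ m' ∈ (∅ : Finset Unit), (((fun _ => (0 : ℝ)) m' : ℝ) : ℂ) •
            (((fun _ => (0 : Matrix (Finset (Orb (FermionTorus 2 L))) (Finset (Orb (FermionTorus 2 L))) ℂ)) m')ᴴ -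
              (fun _ => (0 : Matrix (Finset (Orb (FermionTorus 2 L))) (Finset (Orb (FermionTorus 2 L))) ℂ)) m') +
          ∑ k ∈ w, a k • ladderWord (word k)) := by
    rw [Finset.sum_empty, zero_add, Complex.ofReal_zero, zero_smul, sub_zero, hcert]
  have h := hubbardTorus_groundState_re_dotProduct_ge_of_sector_certificate_annihilators (L := L) hL ht
    hU hψN hψ1 hHψ sz Gn hGn R R' H (κ := 0) (u := E₀) le_rfl le_rfl hΛ O s Xc s' Y Y' uc b cw hcw
    ∅ (fun _ => (0 : ℝ)) (fun _ => 0) w a word (c := c) hcert'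
  have hE : (star ψ ⬝ᵥ H *ᵥ ψ).re = E₀ := by
    rw [hHψ, dotProduct_smul, hψ1, smul_eq_mul, mul_one, Complex.ofReal_re]
  rw [hE] at h
  exact h

end Annihilators

end Literature.MathematicalPhysics.QuantumLattice
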